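import Mathlib.Algebra.Field.ULift
import Mathlib.Algebra.Ring.ULift
import Literature.NumberTheory.Transcendental.ZilberClosedClassOver
import Literature.NumberTheory.Transcendental.ZilberFieldAutomorphisms
import Literature.ModelTheory.Quasiminimal.ClassExtendClosure
import HarnessLib

/-!
# Automorphisms of uncountable Zilber fields extending isomorphisms of closures, in every universe (Kirby 2010 Thm 3.3 / KMO 2012 §3.5)

J. Kirby, A. Macintyre, A. Onshuus, *The algebraic numbers definable in various exponential
fields*, J. Inst. Math. Jussieu 11 (2012), §3.5, Proposition, proof: "This follows from the
quasiminimal excellence of the class of Zilber fields and Theorem 3.3 in [K3]" (J. Kirby, *On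
quasiminimal excellent classes*, JSL 75 (2010)). The tree proves Zilber's categoricity theorem
through Haykazyan's quasiminimal pregeometry classes: Zilber fields (in any universe `Type u`) with a base point
`P = ecl(∅) → K` form the class `ZilberClosedClassOver P` in the language `Language.eclIsoOver P`
(`ZilberClosedClassOver.lean`), whose class axioms are all proved, and Kirby's Thm 3.3 over the
closure of a finite set across two members is
`IsQuasiminimalPregeometryClass.exists_equiv_extend_of_clIndep_finite` (`ClassExtendClosure.lean`).
Here we draw the consequence for ONE uncountable Zilber field `K` (in `Type u`): **every isomorphism
of exponential fields `g : ecl(b) ≅ ecl(b')` between the closures of finite tuples is the restriction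
of an automorphism of `K`** (`ZilberAutomorphisms.exists_equiv_of_isEIsoOn_of_uncountable`). The two
members are `K` with the base point `ecl(∅) ↪ K` and (a copy `ULift K` of) `K` with the base point
`ecl(∅) ≅_{g} ecl(∅) ↪ K` twisted by `g`, so that isomorphisms of `Language.eclIsoOver P`-structures
between them are exactly the automorphisms of the exponential field extending `g|ecl(∅)`.

With the countable case (`ZilberAutomorphisms.exists_equiv_of_isGammaIsoTw₂_of_countable`) and the
hull-to-closure step (`ZilberAutomorphisms.exists_isEIsoOn_of_isGammaIsoTw₂`) this gives the Γ-form of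
the KMO Proposition for every Zilber field in every universe (`ZilberAutomorphisms.exists_equiv_of_isGammaIsoTw₂₀`;
the subscript `₀` records that the first accepted version of this file was the `Type` case).

Everything is proved; no named fact is introduced.

## References

* J. Kirby, A. Macintyre, A. Onshuus, J. Inst. Math. Jussieu 11 (2012) 825–834: §3.5 Proposition.
* J. Kirby, *On quasiminimal excellent classes*, J. Symbolic Logic 75 (2010) 551–564: Thm 3.3,
  Prop. 3.5.
* M. Bays, J. Kirby, Algebra & Number Theory 12 (2018) 493–549: Remark 6.6, Thm 9.1.
-/

noncomputable section

universe u

open Set Cardinal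
open FirstOrder FirstOrder.Language

namespace Literature.NumberTheory.Transcendental

namespace ZilberAutomorphisms

open GammaField ZilberHomogeneity Literature.ModelTheory.ExponentialFields
  Literature.ModelTheory.ExponentialFields.ExponentialRing Literature.ModelTheory.Quasiminimal

variable {K : Type u} [Field K] [CharZero K] [ExponentialRing K]

set_option maxHeartbeats 800000 in
/-- **Isomorphisms between closures of finite tuples of an uncountable Zilber field extend to
automorphisms** (Kirby 2010, Thm 3.3 with `G = ecl(b)`, `H = H'` the field; Prop. 3.5: "Any model
in `𝒞` is `ℵ₀`-homogeneous … over every closed submodel"; the statement behind KMO 2012, §3.5).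
Let `K` be an uncountable Zilber field (in `Type u`) and `g : ecl(b) ≅ ecl(b')` an isomorphism of
exponential fields between the closures of finite tuples. Then some automorphism of the exponential
field `K` restricts to `g`. Proof: `K` with the base point `ecl(∅) ↪ K`, and the copy `ULift K` with
the base point twisted by `g|ecl(∅)` (an automorphism of `ecl(∅)`, as `g` preserves closures), are
members of the quasiminimal pregeometry class `ZilberClosedClassOver (ecl ∅)`; `g` followed by the
copy map is a partial `Language.eclIsoOver`-embedding on `ecl(b)` with closed image (its restrictions
to closures of finite tuples are isomorphisms of pointed closures over the base points), so
`exists_equiv_extend_of_clIndep_finite` (with a finite basis `I` of `ecl(b)`) extends it to an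
isomorphism of structures, i.e. of exponential fields, and we compose back with the copy map.
[cite: Kirby2010QMEC, Thm 3.3 and Prop. 3.5] [cite: KirbyMacintyreOnshuus2012, §3.5 Proposition] -/
theorem exists_equiv_of_isEIsoOn_of_uncountable (hK : IsZilberField K) (hKu : ℵ₀ < #K)
    {m n : ℕ} {b : Fin m → K} {b' : Fin n → K} {g : K → K}
    (hg : IsEIsoOn g (ecl (range b)) (ecl (range b'))) :
    ∃ ρ : ExponentialRingEquiv K K, EqOn ρ g (ecl (range b)) := by
  classical
  haveI : Uncountable K := Cardinal.aleph0_lt_mk_iff.1 hKu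
  -- the prime model as base, and the base point of `K`
  let P := Khovanskii.eclSubfield (∅ : Set K)
  letI iB₁ : EclBasePoint P K := ⟨Khovanskii.eclSubfield.eHom ∅⟩
  have hι : Set.range (basePt P K) = ecl (∅ : Set K) := by
    ext a
    constructor
    · rintro ⟨p, rfl⟩; exact p.2
    · intro ha; exact ⟨⟨a, ha⟩, rfl⟩
  have hιmem : ∀ p, basePt P K p ∈ ecl (∅ : Set K) := fun p => p.2
  -- `g` on `ecl ∅ ⊆ ecl b`
  have hsub : ecl (∅ : Set K) ⊆ ecl (range b) := ecl_mono (empty_subset _)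
  let gP : ExponentialRingHom P K :=
    { toFun := fun p => g p
      map_one' := hg.map_one
      map_mul' := fun p q => hg.map_mul (hsub p.2) (hsub q.2)
      map_zero' := hg.map_zero
      map_add' := fun p q => hg.map_add (hsub p.2) (hsub q.2)
      map_exp' := fun p => hg.map_exp (hsub p.2) }
  have hgP : ∀ p : P, gP p = g p := fun _ => rfl
  have hgempty : g '' ecl (∅ : Set K) = ecl ∅ := by
    rw [hg.image_ecl (empty_subset _), image_empty]
  -- the copy `ULift K` with the twisted base point
  letI iE : ExponentialRing (ULift.{0, u} K) :=
    { exp := fun x => ⟨exp x.down⟩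
      exp_zero := by ext; exact ExponentialRing.exp_zero
      exp_add := fun x y => by ext; exact ExponentialRing.exp_add x.down y.down }
  haveI iC : CharZero (ULift.{0, u} K) := ⟨fun a c h => by
    have := congrArg ULift.down h
    simpa using this⟩
  let e₀ : ExponentialRingEquiv K (ULift.{0, u} K) :=
    { toRingEquiv := ULift.ringEquiv.symm
      map_exp' := fun _ => rfl }
  have he₀ : ∀ x : K, e₀ x = ULift.up x := fun _ => rfl
  have he₀symm : ∀ y : ULift.{0, u} K, e₀.symm y = y.down := fun _ => rfl
  have hK₂ : IsZilberField (ULift.{0, u} K) := IsZilberField.of_exponentialRingEquiv e₀ hK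
  have hK₂u : ℵ₀ < #(ULift.{0, u} K) := by rw [Cardinal.mk_uLift, Cardinal.lift_uzero]; exact hKu
  letI iB₂ : EclBasePoint P (ULift.{0, u} K) := ⟨e₀.toExponentialRingHom.comp gP⟩
  have hι₂apply : ∀ p : P, basePt P (ULift.{0, u} K) p = e₀ (g p) := fun _ => rfl
  have hι₂ : Set.range (basePt P (ULift.{0, u} K)) = ecl (∅ : Set (ULift.{0, u} K)) := by
    have h1 : Set.range (basePt P (ULift.{0, u} K)) = e₀ '' (g '' ecl (∅ : Set K)) := by
      ext y
      constructor
      · rintro ⟨p, rfl⟩; exact ⟨g p, ⟨p, p.2, rfl⟩, rfl⟩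
      · rintro ⟨_, ⟨a, ha, rfl⟩, rfl⟩; exact ⟨⟨a, ha⟩, rfl⟩
    rw [h1, hgempty, Khovanskii.image_ecl_equiv e₀ ∅, image_empty]
  -- the class and its two members
  have h𝒞 := ZilberClosedClassOver.isQuasiminimalPregeometryClass (P := P)
  have hH : ZilberClosedClassOver P K ecl := zilberClosedClassOver_of_isZilberField hK hKu hι
  have hH' : ZilberClosedClassOver P (ULift.{0, u} K) ecl := zilberClosedClassOver_of_isZilberField hK₂ hK₂u hι₂
  -- a finite basis `I` of `ecl b`
  obtain ⟨I, hIbasis⟩ := (isPregeometry_ecl K).matroid.exists_isBasis (range b) (subset_univ _)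
  have hIfin : I.Finite := (finite_range b).subset hIbasis.subset
  have hI : ClIndep ecl I := ((isPregeometry_ecl K).matroid_indep_iff).1 hIbasis.indep
  have hclI : ecl I = ecl (range b) := by
    have := hIbasis.closure_eq_closure
    rwa [(isPregeometry_ecl K).matroid_closure, (isPregeometry_ecl K).matroid_closure] at this
  -- the partial embedding `f = e₀ ∘ g` on `ecl b`
  let f : K → ULift.{0, u} K := fun z => e₀ (g z)
  have hf : IsPartialEmbOn (Language.eclIsoOver P) f (ecl I) := by
    intro k t ht
    rw [hclI] at ht
    refine eqQFType₂_of_eclIsoOver hιmem ?_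
    -- the isomorphism of pointed closures `ecl(t) ≅ ecl(f t)` over the base points: `f` itself
    have htsub : range t ⊆ ecl (range b) := by rintro _ ⟨i, rfl⟩; exact ht i
    have hgt : IsEIsoOn g (ecl (range t)) (ecl (g '' range t)) := hg.restrict htsub
    let ψ : ExponentialRingHom (Khovanskii.eclSubfield (range t)) (ULift.{0, u} K) :=
      e₀.toExponentialRingHom.comp
        ((Khovanskii.eclSubfield.eHom (g '' range t)).comp hgt.equiv.toExponentialRingHom)
    have hψ : ∀ a : Khovanskii.eclSubfield (range t), ψ a = e₀ (g a) := fun _ => rfl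
    refine ⟨ψ, ?_, fun i => by rw [hψ]; rfl, fun p hp => by rw [hψ, hι₂apply]; rfl⟩
    have hecl : ecl (range (f ∘ t)) = e₀ '' (g '' ecl (range t)) := by
      rw [hgt.image_ecl (subset_ecl _), Khovanskii.image_ecl_equiv e₀, range_comp, image_image]
    rw [hecl]
    ext y
    constructor
    · rintro ⟨a, rfl⟩; exact ⟨g a, ⟨a, a.2, rfl⟩, (hψ a).symm⟩
    · rintro ⟨_, ⟨a, ha, rfl⟩, rfl⟩; exact ⟨⟨a, ha⟩, hψ _⟩
  have hfimg : ecl (f '' ecl I) = f '' ecl I := by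
    have : f '' ecl I = e₀ '' (g '' ecl (range b)) := by rw [hclI, image_image]
    rw [this, hg.bijOn.image_eq, Khovanskii.image_ecl_equiv e₀, Khovanskii.ecl_ecl]
  -- Kirby's Theorem 3.3
  have hcard : #K = #(ULift.{0, u} K) := by rw [Cardinal.mk_uLift, Cardinal.lift_uzero]
  obtain ⟨Φ, hΦ⟩ := h𝒞.exists_equiv_extend_of_clIndep_finite hH hH' hcard hIfin hI hf hfimg
  -- back to `K`
  let ρ₀ : ExponentialRingEquiv K (ULift.{0, u} K) := ExponentialRingEquiv.ofEclIsoOverEquiv Φ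
  refine ⟨ρ₀.trans e₀.symm, fun z hz => ?_⟩
  rw [ExponentialRingEquiv.trans_apply]
  have hz' : z ∈ ecl I := by rw [hclI]; exact hz
  have h1 : ρ₀ z = f z := hΦ hz'
  rw [h1, he₀symm]
  rfl

/-- **The Γ-form of the KMO Proposition for every Zilber field, in every universe** (Kirby–Macintyre–Onshuus
2012, §3.5, Proposition; Kirby 2010 Thm 2.1 + Thm 3.3): for kernel generators `τ₁, τ₂`, an
isomorphism `σ₀ : ℚ^{ab}(τ₁) ≅ ℚ^{ab}(τ₂)` of base Γ-fields and a cross Γ-isomorphism `c₀ ↦ c₀'`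
over `σ₀` with `ℚτ₁ + ℚc₀ ◁ K`, `ℚτ₂ + ℚc₀' ◁ K`, some automorphism of the exponential field `K`
maps `c₀ ↦ c₀'` and is `σ₀` on `ℚ^{ab}(τ₁)`. Countable `K`:
`exists_equiv_of_isGammaIsoTw₂_of_countable`; uncountable `K`: hull to closure
(`exists_isEIsoOn_of_isGammaIsoTw₂`) and closure to the field
(`exists_equiv_of_isEIsoOn_of_uncountable`). [cite: KirbyMacintyreOnshuus2012, §3.5 Proposition]
[cite: Kirby2010QMEC, Thm 2.1 and Thm 3.3] -/
theorem exists_equiv_of_isGammaIsoTw₂₀ (hK : IsZilberField K)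
    {τ₁ τ₂ : K} (hker₁ : expKernel K = AddSubgroup.zmultiples τ₁)
    (hker₂ : expKernel K = AddSubgroup.zmultiples τ₂) (hτ₁ : τ₁ ≠ 0) (hτ₂ : τ₂ ≠ 0)
    {σ₀ : fieldOf (Submodule.span ℚ ({τ₁} : Set K)) ≃+* fieldOf (Submodule.span ℚ ({τ₂} : Set K))}
    (hσ₀ : IsEBaseIso₂ (Submodule.span ℚ ({τ₁} : Set K)) (Submodule.span ℚ ({τ₂} : Set K)) σ₀)
    {N : ℕ} {c₀ c₀' : Fin N → K} (hiso : IsGammaIsoTw₂ σ₀ c₀ c₀')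
    (hs : IsStrong (Submodule.span ℚ {τ₁} ⊔ Submodule.span ℚ (range c₀)))
    (hs' : IsStrong (Submodule.span ℚ {τ₂} ⊔ Submodule.span ℚ (range c₀'))) :
    ∃ ρ : ExponentialRingEquiv K K, (∀ j, ρ (c₀ j) = c₀' j) ∧
      ∀ k : fieldOf (Submodule.span ℚ ({τ₁} : Set K)), ρ k = σ₀ k := by
  by_cases hc : Countable K
  · exact exists_equiv_of_isGammaIsoTw₂_of_countable hK hker₁ hker₂ hτ₁ hτ₂ hσ₀ hiso hs hs'
  · have hKu : ℵ₀ < #K := by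
      rw [Cardinal.aleph0_lt_mk_iff, ← not_countable_iff]; exact hc
    obtain ⟨g, hg, hgc, hgk⟩ := exists_isEIsoOn_of_isGammaIsoTw₂ hK hker₁ hker₂ hτ₁ hτ₂ hσ₀ hiso hs hs'
    obtain ⟨ρ, hρ⟩ := exists_equiv_of_isEIsoOn_of_uncountable hK hKu hg
    have hexp₁ : exp τ₁ = 1 := ZilberPrimeModel.exp_eq_one_of_expKernel hker₁
    refine ⟨ρ, fun j => ?_, fun k => ?_⟩
    · rw [hρ (subset_ecl _ ⟨j, rfl⟩), hgc j]
    · rw [hρ (coe_fieldOf_span_singleton_subset_ecl hexp₁ _ k.2), hgk k]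

end ZilberAutomorphisms

end Literature.NumberTheory.Transcendental
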